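import Mathlib
import Summits.Ventures.PercRepro2.Defs
import Summits.Ventures.PercRepro2.Independence
import Summits.Ventures.PercRepro2.Harris
import Summits.Ventures.PercRepro2.Graph
import Summits.Ventures.PercRepro2.Exploration
import Summits.Ventures.PercRepro2.Events
import Summits.Ventures.PercRepro2.FourFunctions
import Summits.Ventures.PercRepro2.Induced
import Summits.Ventures.PercRepro2.Frontier
import Summits.Ventures.PercRepro2.ObsIndependence
import Summits.Ventures.PercRepro2.BHK
import Summits.Ventures.PercRepro2.BHKEvents
import Summits.Ventures.PercRepro2.CaseOneRegime
import Summits.Ventures.PercRepro2.CaseOnePos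

/-!
# `PC1 ⟹ (J1₁)`: the per-case statement implies the one-sided (J1) at table level (blind cell
PercRepro2, p1 g13; lead g23 tri/README «(J1₁) — THE ONE-SIDED (J1) AT TABLE LEVEL» 22:37Z:
«Cov_μ(σ_b, H₁) = PC1 + inner₁ with inner₁ ≥ 0 (Harris), so PC1 ≥ 0 ⟹ (J1₁) ⟹ (J1)»)

**(J1₁)**: `γ · Cov_μ(σ_b, 1[a₃ ∈ C₁]) ≥ Cov_μ(σ_b, 1[a₃ ∈ C₁, o ∈ C₂])` — a FIVE-MARK TABLE inequality
(every event a cluster-membership event under `Q = {a₁ ↮ a₂}`, `γ = P(o ∈ U ∣ Q, a₃ ∉ U)`); with its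
`a₁ ↔ a₂` mirror it gives `(J1)` by addition. Cleared by `D · P(Q)²` (**`JOneOne`**):
`D · covExprC (1[a₃ ∈ C₁] · 1[o ∈ C₂]) ≤ D_o · covExpr 1[a₃ ∈ ·]`, where **`covExprC G`** is the
cleared covariance `P(Q) E[σ_b G 1_Q] − E[σ_b 1_Q] E[G 1_Q]` of `σ_b` with a functional `G` of the
whole configuration (`covExpr F = covExprC (F ∘ C₁)`). A definition only: CANDIDATE, two codes
(lead j11.py n = 5 FULL three palettes 15,120 each, n = 6 m ≤ 9 {1,7}/8 115,200, both NEG-28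
witnesses; engine D224; 0 failures), OUTSIDE the table cone (mine-a, kit j229177).

**THEOREM `jOneOne_of_pc1`: `PC1 ⟹ (J1₁)`.** By `pc1_iff_threshold`, `PC1` is
`D · covExpr (1[a₃ ∈ ·] π′(o)) ≤ D_o · covExpr 1[a₃ ∈ ·]`, so it suffices that
`covExprC (1[a₃ ∈ C₁] 1[o ∈ C₂]) ≤ covExpr (1[a₃ ∈ ·] π′(o))` (**`covExprC_le_covExpr_pi`**): the
means agree by the tower identity (`expect_clusterFun_inter_eq_expect`, `𝓥 = {S ∋ o}`), the
`b ∈ C₁` halves agree by the same identity with `F = 1[b ∈ ·] 1[a₃ ∈ ·]`, and the `b ∈ C₂` halves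
compare by Harris in `G ∖ C₁`: `P_{G∖W}(b, o ∈ C(a₂)) ≥ π′_W(b) π′_W(o)` (**`delClusterProb_mul_le`**,
from `prob_mul_prob_le_prob_inter`), the tower identity with `𝓥 = {S ∋ b, o}` and with
`F = 1[a₃ ∈ ·] π′(o)`, `𝓥 = {S ∋ b}`. Hence also **`jOneOne_of_hosts_le_ae`**: `(J1₁)` in the
monotone-host regime. Nothing beyond is claimed. -/

namespace Summit.Ventures.PercRepro2

namespace CaseOne

section HarrisDel
variable {V : Type*} {E : Type*} [Fintype E] [DecidableEq E] {R : Type*} [CommRing R]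
  [LinearOrder R] [IsStrictOrderedRing R]

omit [Fintype E] [DecidableEq E] in
/-- `delConfig` is monotone in the configuration. -/
lemma delConfig_mono (ends : E → Sym2 V) (W : Set V) {ω ω' : Config E} (h : ω ≤ ω') :
    delConfig ends W ω ≤ delConfig ends W ω' := by
  intro e
  by_cases he : e ∈ touches ends W
  · rw [delConfig_apply_of_mem he, delConfig_apply_of_mem he]
  · rw [delConfig_apply_of_notMem he, delConfig_apply_of_notMem he]
    exact h e

omit [Fintype E] [DecidableEq E] in
/-- For an up-set `𝓥`, `{ω ∣ C_t(G ∖ W, ω) ∈ 𝓥}` is an increasing event. -/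
lemma isUpperSet_delCluster (ends : E → Sym2 V) (t : V) (W : Set V) {𝓥 : Set (Set V)}
    (h𝓥 : IsUpperSet 𝓥) :
    IsUpperSet {ω : Config E | cluster ends (delConfig ends W ω) t ∈ 𝓥} := by
  intro ω ω' h hω
  exact h𝓥 (cluster_mono (delConfig_mono ends W h) t) hω

/-- **Harris in `G ∖ W`**: `π_W(𝓥₁) · π_W(𝓥₂) ≤ π_W(𝓥₁ ∩ 𝓥₂)` for up-sets `𝓥₁, 𝓥₂`
(`delClusterProb`). -/
theorem delClusterProb_mul_le (p : E → R) (hp : IsProbVec p) (ends : E → Sym2 V) (t : V)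
    (W : Set V) {𝓥₁ 𝓥₂ : Set (Set V)} (h₁ : IsUpperSet 𝓥₁) (h₂ : IsUpperSet 𝓥₂) :
    delClusterProb p ends t 𝓥₁ W * delClusterProb p ends t 𝓥₂ W ≤
      delClusterProb p ends t (𝓥₁ ∩ 𝓥₂) W := by
  unfold delClusterProb
  have h := prob_mul_prob_le_prob_inter hp (isUpperSet_delCluster ends t W h₁)
    (isUpperSet_delCluster ends t W h₂)
  exact h.trans (le_of_eq (congrArg (prob p) (Set.ext fun ω => Iff.rfl)))

end HarrisDel

section J11
variable {V : Type*} {E : Type*} [Fintype E] [DecidableEq E] [Fintype V] [DecidableEq V]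
  {R : Type*} [CommRing R] [LinearOrder R] [IsStrictOrderedRing R]

omit [Fintype V] [DecidableEq V] [LinearOrder R] [IsStrictOrderedRing R] in
/-- **The cleared covariance of `σ_b` with a functional of the whole configuration**:
`P(Q) · E[σ_b G 1_Q] − E[σ_b 1_Q] · E[G 1_Q]`. -/
noncomputable def covExprC (p : E → R) (ends : E → Sym2 V) (a₁ a₂ b : V) (G : Config E → R) : R :=
  prob p (connEvent ends a₁ a₂)ᶜ *
      expect p (fun ω => sigmaB ends a₁ a₂ b ω * G ω * ((connEvent ends a₁ a₂)ᶜ).indicator 1 ω) -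
    expect p (fun ω => sigmaB ends a₁ a₂ b ω * ((connEvent ends a₁ a₂)ᶜ).indicator 1 ω) *
      expect p (fun ω => G ω * ((connEvent ends a₁ a₂)ᶜ).indicator 1 ω)

omit [Fintype V] [DecidableEq V] [LinearOrder R] [IsStrictOrderedRing R] in
/-- `covExpr F = covExprC (F ∘ C₁)`. -/
lemma covExpr_eq_covExprC (p : E → R) (ends : E → Sym2 V) (a₁ a₂ b : V) (F : Set V → R) :
    covExpr p ends a₁ a₂ b F = covExprC p ends a₁ a₂ b (fun ω => F (cluster ends ω a₁)) := rfl

/-- **`(J1₁)`, cleared by `D · P(Q)²`**: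
`D · Cov_μ(σ_b, 1[a₃ ∈ C₁] 1[o ∈ C₂]) ≤ D_o · Cov_μ(σ_b, 1[a₃ ∈ C₁])`, i.e.
`γ · Cov_μ(σ_b, 1[a₃ ∈ C₁]) ≥ Cov_μ(σ_b, 1[a₃ ∈ C₁, o ∈ C₂])` when `D, P(Q) > 0`. A definition only
(CANDIDATE, two codes, 0 failures; outside the table cone). -/
def JOneOne (p : E → R) (ends : E → Sym2 V) (o a₁ a₂ a₃ b : V) : Prop :=
  Dpd p ends a₁ a₂ a₃ *
      covExprC p ends a₁ a₂ b (fun ω => ({W' : Set V | a₃ ∈ W'}).indicator 1 (cluster ends ω a₁) *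
        ({S : Set V | o ∈ S}).indicator 1 (cluster ends ω a₂)) ≤
    Dpdo p ends o a₁ a₂ a₃ * covExpr p ends a₁ a₂ b (({W' : Set V | a₃ ∈ W'}).indicator 1)

omit [Fintype V] [DecidableEq V] in
/-- `{S ∋ v}` is an up-set of vertex sets. -/
private lemma isUpperSet_mem'' (v : V) : IsUpperSet {S : Set V | v ∈ S} :=
  fun _ _ h hv => h hv

omit [DecidableEq V] in
/-- **The inner Harris term has the right sign**:
`Cov_μ(σ_b, 1[a₃ ∈ C₁] 1[o ∈ C₂]) ≤ Cov_μ(σ_b, 1[a₃ ∈ C₁] π′_{C₁}(o))` (cleared). -/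
theorem covExprC_le_covExpr_pi (p : E → R) (hp : IsProbVec p) (ends : E → Sym2 V)
    (o a₁ a₂ a₃ b : V) :
    covExprC p ends a₁ a₂ b (fun ω => ({W' : Set V | a₃ ∈ W'}).indicator 1 (cluster ends ω a₁) *
        ({S : Set V | o ∈ S}).indicator 1 (cluster ends ω a₂)) ≤
      covExpr p ends a₁ a₂ b (fun W => ({W' : Set V | a₃ ∈ W'}).indicator 1 W *
        delClusterProb p ends a₂ {S | o ∈ S} W) := by
  classical
  set I₃ : Set V → R := ({W' : Set V | a₃ ∈ W'}).indicator 1 with hI₃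
  set Ib : Set V → R := ({S : Set V | b ∈ S}).indicator 1 with hIb
  set Q := (connEvent ends a₁ a₂)ᶜ with hQ
  set πo := delClusterProb p ends a₂ {S : Set V | o ∈ S} with hπo
  set πb := delClusterProb p ends a₂ {S : Set V | b ∈ S} with hπb
  -- the means agree
  have hmean := expect_clusterFun_inter_eq_expect p ends a₁ a₂ I₃ {S : Set V | o ∈ S}
  -- the `b ∈ C₁` halves agree
  have hbL := expect_clusterFun_inter_eq_expect p ends a₁ a₂ (fun W => Ib W * I₃ W)
    {S : Set V | o ∈ S}
  -- the `b ∈ C₂` halves: tower with `𝓥 = {S ∋ b, o}` and with `F = I₃ πo`, `𝓥 = {S ∋ b}`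
  have hbH := expect_clusterFun_inter_eq_expect p ends a₁ a₂ I₃
    ({S : Set V | b ∈ S} ∩ {S : Set V | o ∈ S})
  have hbH' := expect_clusterFun_inter_eq_expect p ends a₁ a₂ (fun W => I₃ W * πo W)
    {S : Set V | b ∈ S}
  -- Harris in `G ∖ W`
  have hHarris : ∀ ω, I₃ (cluster ends ω a₁) * (πb (cluster ends ω a₁) * πo (cluster ends ω a₁)) *
      Q.indicator 1 ω ≤
      I₃ (cluster ends ω a₁) * delClusterProb p ends a₂ ({S : Set V | b ∈ S} ∩ {S : Set V | o ∈ S})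
        (cluster ends ω a₁) * Q.indicator 1 ω := by
    intro ω
    have h := delClusterProb_mul_le p hp ends a₂ (cluster ends ω a₁) (isUpperSet_mem'' (V := V) b)
      (isUpperSet_mem'' (V := V) o)
    have hI : 0 ≤ I₃ (cluster ends ω a₁) := Set.indicator_apply_nonneg fun _ => zero_le_one
    have hQ0 : 0 ≤ Q.indicator (1 : Config E → R) ω := Set.indicator_apply_nonneg fun _ => zero_le_one
    have := mul_le_mul_of_nonneg_left h hI
    exact mul_le_mul_of_nonneg_right this hQ0
  have hexp := expect_mono hp hHarris
  -- assemble
  unfold covExprC covExpr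
  -- rewrite the `σ_b`-expectations as differences
  have e1 : expect p (fun ω => sigmaB ends a₁ a₂ b ω *
      (I₃ (cluster ends ω a₁) * ({S : Set V | o ∈ S}).indicator 1 (cluster ends ω a₂)) *
      Q.indicator 1 ω) =
      expect p (fun ω => (fun W => Ib W * I₃ W) (cluster ends ω a₁) *
          ({S : Set V | o ∈ S}).indicator 1 (cluster ends ω a₂) * Q.indicator 1 ω) -
        expect p (fun ω => I₃ (cluster ends ω a₁) *
          ({S : Set V | b ∈ S} ∩ {S : Set V | o ∈ S}).indicator 1 (cluster ends ω a₂) *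
          Q.indicator 1 ω) := by
    rw [← expect_sub]
    congr 1
    funext ω
    simp only [Pi.sub_apply, sigmaB, hIb, hI₃, Set.inter_indicator_one, Pi.mul_apply]
    ring
  have e2 : expect p (fun ω => sigmaB ends a₁ a₂ b ω *
      (fun W => I₃ W * πo W) (cluster ends ω a₁) * Q.indicator 1 ω) =
      expect p (fun ω => (fun W => Ib W * I₃ W) (cluster ends ω a₁) * πo (cluster ends ω a₁) *
          Q.indicator 1 ω) -
        expect p (fun ω => (fun W => I₃ W * πo W) (cluster ends ω a₁) *
          Ib (cluster ends ω a₂) * Q.indicator 1 ω) := by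
    rw [← expect_sub]
    congr 1
    funext ω
    simp only [Pi.sub_apply, sigmaB, hIb, hI₃]
    ring
  rw [e1, e2, hbL, hbH, hbH', hmean]
  have hP : 0 ≤ prob p Q := prob_nonneg hp _
  have key : expect p (fun ω => (fun W => I₃ W * πo W) (cluster ends ω a₁) * πb (cluster ends ω a₁) *
      Q.indicator 1 ω) ≤
      expect p (fun ω => I₃ (cluster ends ω a₁) *
        delClusterProb p ends a₂ ({S : Set V | b ∈ S} ∩ {S : Set V | o ∈ S}) (cluster ends ω a₁) *
        Q.indicator 1 ω) := by
    refine le_trans (le_of_eq ?_) hexp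
    congr 1
    funext ω
    ring
  nlinarith [key, hP]

omit [DecidableEq V] in
/-- **`PC1 ⟹ (J1₁)`**: the per-case statement implies the one-sided (J1) at table level. -/
theorem jOneOne_of_pc1 (p : E → R) (hp : IsProbVec p) (ends : E → Sym2 V) (o a₁ a₂ a₃ b : V)
    (h : PC1 p ends o a₁ a₂ a₃ b) : JOneOne p ends o a₁ a₂ a₃ b := by
  rw [pc1_iff_threshold] at h
  unfold JOneOne
  have hD : 0 ≤ Dpd p ends a₁ a₂ a₃ := prob_nonneg hp _
  have := mul_le_mul_of_nonneg_left (covExprC_le_covExpr_pi p hp ends o a₁ a₂ a₃ b) hD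
  exact this.trans h

omit [DecidableEq V] in
/-- **`(J1₁)` in the monotone-host regime** (almost-sure form). -/
theorem jOneOne_of_hosts_le_ae (p : E → R) (hp : IsProbVec p) (ends : E → Sym2 V)
    (o a₁ a₂ a₃ b : V)
    (h : ∀ ω : Config E, weight p ω ≠ 0 → ω ∈ (connEvent ends a₁ a₂)ᶜ →
      a₃ ∈ cluster ends ω a₁ →
        Dpd p ends a₁ a₂ a₃ * delClusterProb p ends a₂ {S | o ∈ S} (cluster ends ω a₁) ≤
          Dpdo p ends o a₁ a₂ a₃) :
    JOneOne p ends o a₁ a₂ a₃ b :=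
  jOneOne_of_pc1 p hp ends o a₁ a₂ a₃ b (pc1_of_hosts_le_ae p hp ends o a₁ a₂ a₃ b h)

end J11

end CaseOne

end Summit.Ventures.PercRepro2
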